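import Mathlib
import Summits.NavierStokesRegularity.FluidComputer.AbcInertiaEigenvalues

/-!
# INERTIA-3L instantiation, Part 9: RATIONAL WEIGHTS — Loewner monotonicity of the Schur term, so that a
# certificate computed with a rational majorant `q ≥ √2` discharges (R1) (instab3 g8; rider (i1′) of
# profile-refuter g7, STATUS l.8892, snippet `HOME/profile/refuter/snippets/LoewnerDiagInv.lean`)

HONEST FRAMING (human ruling D-0035): nothing here is a claim about Navier–Stokes blow-up.
WHAT THIS IS NOT: not NS evidence. MODEL lane (forced-ABC linearisation, class II); finite-dimensional
linear algebra; no certificate, number or census word moves.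

Hypothesis (R1) of `AbcInertiaCount.finrank_le_of_inertia_certificate` carries the REAL `√2` in the tail
constants `E_l = |O_l|²/R + a − √2`. A program that prints exact rationals certifies the SAME inequality with
`E'_l = |O_l|²/R + a − q` for a rational `q ≥ √2` (or encloses `√2` in a ball, i3/i4). Since `0 < E' ≤ E` gives
`diag(E⁻¹) ≼ diag(E'⁻¹)` in the Loewner order, `M₀ + ½F₂diag(E'⁻¹)F₂ᵀ ≺ 0 ⇒ M₀ + ½F₂diag(E⁻¹)F₂ᵀ ≺ 0`:
* `dotProduct_conjDiag_mulVec`, `dotProduct_conjDiagInv_mono`, `form_neg_of_form_neg_smallerWeights`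
  (the refuter's snippet, re-proved here);
* `card_classII_eigenfunctions_le_of_inertia_certificate_ratWeights` — the end-to-end class-II theorem with
  (R1) stated for the weights `E'_l = |O_l|²/R + a − q`, `√2 ≤ q < (⌊r_H²⌋+1)/R + a` (then (R3) follows too).

Mathlib + `AbcInertiaEigenvalues`; no new definitions; std axioms. [folklore]
-/

noncomputable section

open scoped BigOperators Matrix
open Finset Matrix MeasureTheory UnitAddTorus

namespace Summit.NavierStokesRegularity.FluidComputer.AbcInertia

open Literature.Analysis.FunctionSpaces Literature.Analysis.FunctionSpaces.Torus
open Literature.Analysis.FluidPDE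
open Summit.NavierStokesRegularity.FluidComputer.AbcClassII

section Loewner

variable {ι κ : Type*} [Fintype ι] [Fintype κ] [DecidableEq κ]

/-- `x ⬝ ((F·diag d·Fᵀ) x) = Σ_l d_l · ((Fᵀ x)_l)²`. -/
theorem dotProduct_conjDiag_mulVec (F : Matrix ι κ ℝ) (d : κ → ℝ) (x : ι → ℝ) :
    x ⬝ᵥ ((F * diagonal d * Fᵀ) *ᵥ x) = ∑ l, d l * ((Fᵀ *ᵥ x) l) ^ 2 := by
  rw [← mulVec_mulVec, ← mulVec_mulVec, dotProduct_mulVec, ← mulVec_transpose]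
  simp only [dotProduct, mulVec_diagonal]
  refine Finset.sum_congr rfl fun l _ => ?_
  ring

/-- **Loewner monotonicity in the diagonal weights**: `0 < E' ≤ E` pointwise ⇒
`x ⬝ (F diag(E⁻¹) Fᵀ) x ≤ x ⬝ (F diag(E'⁻¹) Fᵀ) x`. -/
theorem dotProduct_conjDiagInv_mono (F : Matrix ι κ ℝ) {E E' : κ → ℝ}
    (hE' : ∀ l, 0 < E' l) (hle : ∀ l, E' l ≤ E l) (x : ι → ℝ) :
    x ⬝ᵥ ((F * diagonal (fun l => (E l)⁻¹) * Fᵀ) *ᵥ x) ≤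
      x ⬝ᵥ ((F * diagonal (fun l => (E' l)⁻¹) * Fᵀ) *ᵥ x) := by
  rw [dotProduct_conjDiag_mulVec, dotProduct_conjDiag_mulVec]
  exact Finset.sum_le_sum fun l _ =>
    mul_le_mul_of_nonneg_right (inv_anti₀ (hE' l) (hle l)) (sq_nonneg _)

/-- **(R1) with smaller weights implies (R1).** If `M₀ + ½ F₂ diag(E'⁻¹) F₂ᵀ` is negative on `x ≠ 0` for
weights `0 < E' ≤ E`, then so is `M₀ + ½ F₂ diag(E⁻¹) F₂ᵀ`. -/
theorem form_neg_of_form_neg_smallerWeights (M₀ : Matrix ι ι ℝ) (F₂ : Matrix ι κ ℝ) {E E' : κ → ℝ}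
    (hE' : ∀ l, 0 < E' l) (hle : ∀ l, E' l ≤ E l)
    (hneg : ∀ x : ι → ℝ, x ≠ 0 →
      x ⬝ᵥ ((M₀ + (1 / 2 : ℝ) • (F₂ * diagonal (fun l => (E' l)⁻¹) * F₂ᵀ)) *ᵥ x) < 0)
    (x : ι → ℝ) (hx : x ≠ 0) :
    x ⬝ᵥ ((M₀ + (1 / 2 : ℝ) • (F₂ * diagonal (fun l => (E l)⁻¹) * F₂ᵀ)) *ᵥ x) < 0 := by
  have h := hneg x hx
  have hmono := dotProduct_conjDiagInv_mono F₂ hE' hle x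
  rw [add_mulVec, dotProduct_add, smul_mulVec, dotProduct_smul] at h ⊢
  have : (1 / 2 : ℝ) • (x ⬝ᵥ ((F₂ * diagonal (fun l => (E l)⁻¹) * F₂ᵀ) *ᵥ x)) ≤
      (1 / 2 : ℝ) • (x ⬝ᵥ ((F₂ * diagonal (fun l => (E' l)⁻¹) * F₂ᵀ) *ᵥ x)) :=
    smul_le_smul_of_nonneg_left hmono (by norm_num)
  linarith

end Loewner

/-! ### The end-to-end theorem with rational (or any majorant) weights -/

/-- **INERTIA-3L, END TO END, WITH A MAJORANT `q ≥ √2` IN THE WEIGHTS (class II, classical form).** As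
`card_classII_eigenfunctions_le_of_inertia_certificate`, but (R1) is assumed for the weights
`E'_l = |O_l|²/R + a − q` with `√2 ≤ q` and `q < (⌊r_H²⌋ + 1)/R + a` (so `0 < E' ≤ E` on `B`, and (R3) holds). -/
theorem card_classII_eigenfunctions_le_of_inertia_certificate_ratWeights {R a rL rH q : ℝ}
    {HL HH HB : Finset Idx} {m : ℕ} (hR : 0 < R) (h0 : 0 ≤ rL) (hLH : rL + 1 ≤ rH)
    (hHL : ∀ i : Idx, i ∈ HL ↔ onormSq i.1 ≤ rL ^ 2)
    (hHH : ∀ i : Idx, i ∈ HH ↔ onormSq i.1 ≤ rH ^ 2)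
    (hHB : ∀ i : Idx, i ∈ HB ↔ rH ^ 2 < onormSq i.1 ∧ onormSq i.1 ≤ (rH + 1) ^ 2)
    (GH Ah : Matrix ↥HH ↥HH ℝ) (AHB : Matrix ↥HH ↥HB ℝ) (ABH : Matrix ↥HB ↥HH ℝ) (E' : ↥HB → ℝ)
    (V : Matrix ↥HH (Fin m) ℝ) (hGH : GHᵀ = GH)
    (hAh : Ah = Matrix.of fun i j : ↥HH => (if i = j then -(onormSq i.1.1 / R) - a else 0) + amat i.1 j.1)
    (hAHB : AHB = Matrix.of fun (i : ↥HH) (l : ↥HB) => amat i.1 l.1)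
    (hABH : ABH = Matrix.of fun (l : ↥HB) (i : ↥HH) => amat l.1 i.1)
    (hq : Real.sqrt 2 ≤ q) (hqR : q < ((⌊rH ^ 2⌋₊ : ℝ) + 1) / R + a)
    (hE' : E' = fun l : ↥HB => onormSq l.1.1 / R + a - q)
    (hR1q : ∀ x : ↥HH → ℝ, x ≠ 0 →
      x ⬝ᵥ ((GH * Ah + Ahᵀ * GH + (1 / 2 : ℝ) • ((GH * AHB + ABHᵀ) * Matrix.diagonal (fun l => (E' l)⁻¹) *
        (GH * AHB + ABHᵀ)ᵀ)) *ᵥ x) < 0)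
    (hR2 : ∀ x : ↥HH → ℝ, 0 ≤ x ⬝ᵥ ((GH + V * Vᵀ) *ᵥ x))
    {n : ℕ} (z : Fin n → ℂ) (hz : Function.Injective z)
    (u : Fin n → UnitAddTorus (Fin 3) → EuclideanSpace ℂ (Fin 3))
    (hu : ∀ k, Torus.LinNSResolventRel (1 / (2 * Real.pi * R)) (Torus.abcFlow 1 1 1) (2 * Real.pi * z k) (u k) 0)
    (hu0 : ∀ k, u k ≠ 0) (hII : ∀ k, IsClassII (mFourierCoeff (u k))) (hre : ∀ k, a ≤ (z k).re) :
    n ≤ m := by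
  classical
  have hR3 : Real.sqrt 2 < ((⌊rH ^ 2⌋₊ : ℝ) + 1) / R + a := lt_of_le_of_lt hq hqR
  -- `0 < E' ≤ E` on `B`
  have hE'pos : ∀ l : ↥HB, 0 < E' l := by
    intro l
    rw [hE']
    have hl : rH ^ 2 < onormSq l.1.1 := ((hHB l.1).mp l.2).1
    obtain ⟨nn, hnn⟩ := exists_onormSq_eq_natCast l.1.1
    have hfl : ((⌊rH ^ 2⌋₊ : ℝ) + 1) ≤ onormSq l.1.1 := by
      rw [hnn] at hl ⊢
      exact_mod_cast (Nat.floor_lt (sq_nonneg _)).mpr hl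
    have := div_le_div_of_nonneg_right hfl hR.le
    show 0 < onormSq l.1.1 / R + a - q
    linarith
  have hle : ∀ l : ↥HB, E' l ≤ (fun l : ↥HB => onormSq l.1.1 / R + a - Real.sqrt 2) l := by
    intro l; rw [hE']; show onormSq l.1.1 / R + a - q ≤ onormSq l.1.1 / R + a - Real.sqrt 2; linarith
  have hR1 := form_neg_of_form_neg_smallerWeights (GH * Ah + Ahᵀ * GH) (GH * AHB + ABHᵀ) hE'pos hle hR1q
  exact card_classII_eigenfunctions_le_of_inertia_certificate hR h0 hLH hHL hHH hHB GH Ah AHB ABH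
    (fun l : ↥HB => onormSq l.1.1 / R + a - Real.sqrt 2) V hGH hAh hAHB hABH rfl hR1 hR2 hR3 z hz u hu hu0 hII hre

end Summit.NavierStokesRegularity.FluidComputer.AbcInertia

end
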